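import Summits.CriticalPhenomena.SAWScalingLimit.Cruxes.TwistedKernelSummable.Lines.birth

/-!
# Strategist sketch — crux `TwistedKernelSummable` (stmt-CriticalPhenomena-17872)

(1) The REPAIR signatures: the crux and its sibling `TwistedKernelTailIndex` restated with the FIRST-STEP free term
`Matrix.of (fun ι κ => ∑ l, T ι l * G (n-1) (z - dir l) l κ)` (kernel and free step on the SAME side), verbatim the
items' text otherwise — ready for `ledger route edit --restate`.  (2) The statements certifying the repair: the unique
first-step kernel is the Literature's twisted lace coefficient `Π^{5/8} = twistedLaceCoefficient (5/8)` (landed identity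
`LaceExpansion.twistedTwoPoint_succ` + bridge `twistedTwoPoint_eq_sum_paths` + uniqueness by strong induction), hence the
restated crux is EQUIVALENT to `LaceKernelSummable` (the registered `stub_laceKernelSummable` of `Lines/birth.lean`, the
card's K1).  (3) The sector-0 gap equation (the DCS sector), companion of `TwistedGapEquation` (sector 1 = alias sector).
(4) The census's transfer T3 statements (`laceJ`, domination, `LaceJTrichotomy`, `AbsLace2D`), the exact spin-shift identities
(S2) and the analytic cut D2 of the surcharge over `Lines/birth.lean`'s vocabulary. Statements only (`sorry`); sizes in the docstrings.
-/

noncomputable section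

open scoped BigOperators
open Literature.Probability.LatticeModels
open Literature.Probability.RandomPlanarGeometry.LaceExpansion
open Literature.Probability.RandomPlanarGeometry.SAW (criticalFugacity)

namespace Summit.CriticalPhenomena.SAWScalingLimit.Cruxes.TwistedKernelSummable.Strategist

/-- REPAIR SIGNATURE for item stmt-CriticalPhenomena-17872: `TwistedKernelSummable` with the first-step free term
(the recursion of `LaceExpansion.twistedTwoPoint_succ`); everything else verbatim. -/
def TwistedKernelSummableFS : Prop :=
  let dir : Fin 4 → Literature.Probability.LatticeModels.Site 2 := ![![1, 0], ![0, 1], ![-1, 0], ![0, -1]]; let σ : ℝ := 5 / 8; let T : Matrix (Fin 4) (Fin 4) ℂ := fun a b => if dir b = -dir a then 0 else Complex.exp (-Complex.I * σ * (Literature.Probability.LatticeModels.turning (-Literature.Probability.LatticeModels.Site.toComplex (dir a)) 0 (Literature.Probability.LatticeModels.Site.toComplex (dir b)) : ℝ)); let G : ℕ → Literature.Probability.LatticeModels.Site 2 → Matrix (Fin 4) (Fin 4) ℂ := fun n z ι κ => if n = 0 then (if z = 0 ∧ ι = κ then 1 else 0) else ∑ p ∈ ((Literature.Probability.LatticeModels.zdGraph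 2).finsetWalkLength n (0 : Literature.Probability.LatticeModels.Site 2) z).filter (fun p => p.IsPath), (if p.getVert 1 = -dir ι ∨ z - p.getVert (n - 1) ≠ dir κ then 0 else Complex.exp (-Complex.I * σ * (Literature.Probability.LatticeModels.winding ((-Literature.Probability.LatticeModels.Site.toComplex (dir ι)) :: (p.support.map Literature.Probability.LatticeModels.Site.toComplex)) : ℝ))); let IsFirstStepKernel : (ℕ → Literature.Probability.LatticeModels.Site 2 → Matrix (Fin 4) (Fin 4) ℂ) → Prop := fun K => (∀ n z, z ∉ Literature.Probability.LatticeModels.box 2 n → K n z = 0) ∧ (∀ n, 1 ≤ n → ∀ z, G n z = Matrix.of (fun ι κ => ∑ l : Fin 4, T ι l * G (n - 1) (z - dir l) l κ) + ∑ m ∈ Finset.Icc 1 n, ∑ y ∈ Literature.Probability.LatticeModels.box 2 m, K m y * G (n - m) (z - y)); ∀ K : ℕ → Literature.Probability.LatticeModels.Site 2 → Matrix (Fin 4) (Fin 4) ℂ, IsFirstStepKernel K → Summable (fun p : ℕ × Literature.Probability.LatticeModels.Site 2 => Literature.Probability.RandomPlanarGeometry.SAW.criticalFugacity ^ p.1 *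 ∑ ι : Fin 4, ∑ κ : Fin 4, ‖K p.1 p.2 ι κ‖)

/-- REPAIR SIGNATURE for item stmt-CriticalPhenomena-17873: `TwistedKernelTailIndex` with the first-step free term. -/
def TwistedKernelTailIndexFS : Prop :=
  let dir : Fin 4 → Literature.Probability.LatticeModels.Site 2 := ![![1, 0], ![0, 1], ![-1, 0], ![0, -1]]; let σ : ℝ := 5 / 8; let T : Matrix (Fin 4) (Fin 4) ℂ := fun a b => if dir b = -dir a then 0 else Complex.exp (-Complex.I * σ * (Literature.Probability.LatticeModels.turning (-Literature.Probability.LatticeModels.Site.toComplex (dir a)) 0 (Literature.Probability.LatticeModels.Site.toComplex (dir b)) : ℝ)); let G : ℕ → Literature.Probability.LatticeModels.Site 2 → Matrix (Fin 4) (Fin 4) ℂ := fun n z ι κ => if n = 0 then (if z = 0 ∧ ι = κ then 1 else 0) else ∑ p ∈ ((Literature.Probability.LatticeModels.zdGraph 2).finsetWalkLength n (0 : Literature.Probability.LatticeModels.Site 2) z).filter (fun p => p.IsPath), (if p.getVert 1 = -dir ι ∨ z - p.getVert (n - 1) ≠ dir κ then 0 else Complex.exp (-Complex.I * σ * (Literature.Probability.LatticeModels.winding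 ((-Literature.Probability.LatticeModels.Site.toComplex (dir ι)) :: (p.support.map Literature.Probability.LatticeModels.Site.toComplex)) : ℝ))); let IsFirstStepKernel : (ℕ → Literature.Probability.LatticeModels.Site 2 → Matrix (Fin 4) (Fin 4) ℂ) → Prop := fun K => (∀ n z, z ∉ Literature.Probability.LatticeModels.box 2 n → K n z = 0) ∧ (∀ n, 1 ≤ n → ∀ z, G n z = Matrix.of (fun ι κ => ∑ l : Fin 4, T ι l * G (n - 1) (z - dir l) l κ) + ∑ m ∈ Finset.Icc 1 n, ∑ y ∈ Literature.Probability.LatticeModels.box 2 m, K m y * G (n - m) (z - y)); ∀ K : ℕ → Literature.Probability.LatticeModels.Site 2 → Matrix (Fin 4) (Fin 4) ℂ, IsFirstStepKernel K → (∀ s : ℝ, 0 ≤ s → s < 3 / 4 → Summable (fun p : ℕ × Literature.Probability.LatticeModels.Site 2 => Literature.Probability.RandomPlanarGeometry.SAW.criticalFugacity ^ p.1 * ‖Literature.Probability.LatticeModels.Site.toComplex p.2‖ ^ s * ∑ ι : Fin 4, ∑ κ : Fin 4, ‖K p.1 p.2 ι κ‖)) ∧ (∀ s : ℝ, 3 /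 4 < s → ¬ Summable (fun p : ℕ × Literature.Probability.LatticeModels.Site 2 => Literature.Probability.RandomPlanarGeometry.SAW.criticalFugacity ^ p.1 * ‖Literature.Probability.LatticeModels.Site.toComplex p.2‖ ^ s * ∑ ι : Fin 4, ∑ κ : Fin 4, ‖K p.1 p.2 ι κ‖))

/-- The card's K1 in the lace convention (= `Birth.LaceKernelSummable`, registered `stub_laceKernelSummable`):
`Σ_{(n,z)} x_c^n Σ_{ι,κ} |Π^{5/8}_n(z)(ι,κ)| < ∞`. -/
def LaceKernelSummable : Prop :=
  Summable (fun p : ℕ × Site 2 =>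
    criticalFugacity ^ p.1 * ∑ ι : Fin 4, ∑ κ : Fin 4, ‖twistedLaceCoefficient (5 / 8) p.1 p.2 ι κ‖)

/-- First checkable lemma of the repair (provable now, size M): every kernel solving the FIRST-STEP recursion of the
item's two-point matrices agrees with `twistedLaceCoefficient (5/8)` from length 1 on (the `m = n` term isolates `K n z`
by `sum_mul_twistedTwoPoint_zero`; `twistedTwoPoint_succ` gives the same identity for `Π`; strong induction on `n`;
the item's `G`, `T`, `dir` are `twistedTwoPoint (5/8)` (`twistedTwoPoint_eq_sum_paths`, `twistedTwoPoint_zero_apply`),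
`twistedStepMatrix (5/8)`, `stepDir`). Consequence: `TwistedKernelSummableFS ↔ LaceKernelSummable`. -/
theorem twistedKernelSummableFS_iff_laceKernelSummable :
    TwistedKernelSummableFS ↔ LaceKernelSummable := by
  sorry

/-- The SECTOR-0 GAP EQUATION (research-open; companion of the route's `TwistedGapEquation`, which is the sector-1 =
spin-(−3/8) ALIAS sector): in the trivial-character sector (eigenvector `(1,1,1,1)`, where the Duminil-Copin–Smirnov
parafermion lives: `F = Σ_κ G(ι,κ)`), `x_c (1 + 2 cos(5π/16)) + Σ_n x_c^n Σ_z Σ_k Π^{5/8}_n(z)(0,k) = 1`, i.e. the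
spin-5/8 sector is ALSO massless at `x_c` (numerics: partial sums 0.886 (N=4) → 0.931 (N=14), this seat's job for N ≤ 30). -/
def SectorZeroGapEquation : Prop :=
  Filter.Tendsto (fun N : ℕ => ∑ n ∈ Finset.range (N + 1), (criticalFugacity : ℂ) ^ n *
      ∑ z ∈ box 2 n, ∑ k : Fin 4, twistedLaceCoefficient (5 / 8) n z 0 k)
    Filter.atTop (nhds (1 - (criticalFugacity : ℂ) * ((1 + 2 * Real.cos (5 * Real.pi / 16) : ℝ) : ℂ)))


/-! ### Card `absolute-lace-domination` (lens transfer): σ-free domination of the lace kernel -/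

/-- The walk-level signed lace sum `J[0,n](ω) = Σ_{L ∈ ℒ[0,n]} ∏_{st∈L} U_st ∏_{s't'∈𝒞(L)} (1 + U_{s't'})`, `U = -𝟙[ω(s)=ω(t)]`
(the real factor inside `twistedLaceCoefficient`). -/
def laceJ (n : ℕ) (ω : ℕ → Site 2) : ℝ :=
  ∑ L ∈ laces 0 n, weight (interaction 1 ω) L * ∏ e ∈ compat 0 n L, (1 + interaction 1 ω e.1 e.2)

/-- FIRST LEMMA of the card (provable now, S): the twisted lace coefficient is dominated, entrywise and for EVERY spin `σ`, by
the σ-free walk-level absolute lace sum (`norm_sum_le` + `norm_twistedWeight = 1`). -/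
theorem norm_twistedLaceCoefficient_le_absLace (σ : ℝ) (n : ℕ) (z : Site 2) (ι κ : Fin 4) :
    ‖twistedLaceCoefficient σ n z ι κ‖ ≤ ∑ ω ∈ nbWalkFun ι κ n z, |laceJ n ω| := by
  sorry

/-- The structural conjecture found exhaustively (all non-backtracking walks, n ≤ 24; `lace_abs.c`, job j024360):
`J[0,n](ω) ∈ {-1, 0, 1}`. (Reduced Euler characteristic of the complex of non-lace-connected subgraphs of the intersection
graph; provable-now candidate, M.) -/
def LaceJTrichotomy : Prop :=
  ∀ (n : ℕ) (ι κ : Fin 4) (z : Site 2), ∀ ω ∈ nbWalkFun ι κ n z, laceJ n ω = -1 ∨ laceJ n ω = 0 ∨ laceJ n ω = 1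

/-- `AbsLace2D` — the load-bearing (research-open) stub of the card: the x_c-weighted COUNT of lace-irreducible memory walks
(equivalently, under `LaceJTrichotomy`, the walk-level absolute lace sum) is summable over the length. σ-free. -/
def AbsLace2D : Prop :=
  Summable (fun p : ℕ × Site 2 =>
    criticalFugacity ^ p.1 * ∑ ι : Fin 4, ∑ κ : Fin 4, ∑ ω ∈ nbWalkFun ι κ p.1 p.2, |laceJ p.1 ω|)

/-- The transfer: `AbsLace2D → LaceKernelSummable` (and the same for every `σ`), by the first lemma and comparison. -/
theorem laceKernelSummable_of_absLace2D : AbsLace2D → LaceKernelSummable := by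
  sorry


/-! ### The exact spin-shift identity behind the census's sector/alias analysis (S2): `σ ↦ σ + 1` is a diagonal unitary conjugation -/

/-- SPIN SHIFT (provable now, S/M): every turning angle of a non-backtracking lattice walk lies in `{0, ±π/2}`, so the total
winding `W_ι(ω)` of a walk with fictitious incoming direction `ι` and last step `κ` is `(π/2)·q` with `q ≡ κ − ι (mod 4)`;
hence `e^{-i(σ+1)W} = i^ι (−i)^κ · e^{-iσW}` and the twisted two-point matrices at spins `σ` and `σ + 1` are conjugate by
`U = diag(i^a)`: all moduli, norms and summability statements of the route are periodic in `σ mod 1` (and, with complex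
conjugation = reflection, symmetric under `σ ↦ 1 − σ`); `U` shifts the C4-character sector label by one, which is why the
route's sector 1 at `σ = 5/8` is the spin-`(−3/8)` observable's sector 0 (the "alias sector"). Numerically confirmed to
2.7e-15 (job j024337: σ = 3/8 vs 5/8 tables). -/
theorem twistedTwoPoint_add_one (σ : ℝ) (n : ℕ) (z : Site 2) (ι κ : Fin 4) :
    twistedTwoPoint (σ + 1) n z ι κ = Complex.I ^ (ι : ℕ) * (-Complex.I) ^ (κ : ℕ) * twistedTwoPoint σ n z ι κ := by
  sorry

/-- The same spin shift for the lace kernel (same walks, same weights; non-backtracking excludes the `±π` turns). -/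
theorem twistedLaceCoefficient_add_one (σ : ℝ) (n : ℕ) (z : Site 2) (ι κ : Fin 4) :
    twistedLaceCoefficient (σ + 1) n z ι κ =
      Complex.I ^ (ι : ℕ) * (-Complex.I) ^ (κ : ℕ) * twistedLaceCoefficient σ n z ι κ := by
  sorry

/-- Consequence (provable now from the two identities): K1 depends on `σ` only through `σ mod 1`. -/
theorem laceKernelSummable_periodic (σ : ℝ) :
    Summable (fun p : ℕ × Site 2 => criticalFugacity ^ p.1 * ∑ ι : Fin 4, ∑ κ : Fin 4, ‖twistedLaceCoefficient (σ + 1) p.1 p.2 ι κ‖) ↔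
    Summable (fun p : ℕ × Site 2 => criticalFugacity ^ p.1 * ∑ ι : Fin 4, ∑ κ : Fin 4, ‖twistedLaceCoefficient σ p.1 p.2 ι κ‖) := by
  sorry


/-! ### Census §Decomposition D2 — the analytic cut of the SURCHARGE (explains (V1); not filed as a line) -/

/-- D2 piece 1 (predicted FALSE — heuristically ⟺ `γ_max < 3/4`, while the alias sector has `γ₁ = 17/16`; numerically
`x_c^n‖G_n‖₁` does not even decay): the parity-respecting lattice gradient of the critical twisted two-point matrices is
n-summable in ℓ¹. This is the statement the mixed free term smuggles into the typed crux. -/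
def TwoPointGradientSummable : Prop :=
  Summable (fun p : ℕ × Site 2 => criticalFugacity ^ p.1 *
    ∑ ι : Fin 4, ∑ κ : Fin 4, ‖twistedTwoPoint (5 / 8) p.1 (p.2 + ![1, 1]) ι κ - twistedTwoPoint (5 / 8) p.1 p.2 ι κ‖)

/-- D2 piece 2 (plausible, short-range): the lace/step commutator `[Π_b, D]` of `Lines/birth.lean` has a summable first
absolute moment. -/
def LaceCommutatorFirstMoment : Prop :=
  Summable (fun p : ℕ × Site 2 => criticalFugacity ^ p.1 * ‖Site.toComplex p.2‖ *
    ∑ ι : Fin 4, ∑ κ : Fin 4, ‖Birth.laceStepCommutator p.1 p.2 ι κ‖)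

/-- D2 glue (provable now, L: discrete Taylor on the even sublattice + Young's inequality for the length convolution):
birth's hardest stub from the two pieces and K1. -/
theorem conjugationSummable_of :
    TwoPointGradientSummable → LaceCommutatorFirstMoment → LaceKernelSummable → Birth.ConjugationSummable := by
  sorry

end Summit.CriticalPhenomena.SAWScalingLimit.Cruxes.TwistedKernelSummable.Strategist

end
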